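import Summits.CriticalPhenomena.PercolationContinuityZ3.Theorems.PercAnnulusCrossingIICErgodic
import HarnessLib

/-!
# `L²`-ergodic theorem for the IIC: pair averages of a local pattern over `Λ(n)²` tend to `P_{p_c}(E)²` (lane RSW3, p1 gen 7)

builds on p205010 (kernel theorem, internal audit signed; external expert review pending) — used only through the (A2)□ ⇒ one-arm
quasi-multiplicativity bridge and `CSH.percolationContinuity_allDimensions` (the `p_c(ℤ^d)` statement); the `ℤ²` statement is unconditional.

Seat `prim-rsw3-p1` (gen 7).  Second-moment companion of `PercAnnulusCrossingIICErgodic.lean`.  For a cylinder event `E` and Kesten's IIC measure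
`ν` write `S_x = {ω | ω + x ∈ E}`.  The first file gives `|Λ(n)|⁻¹ Σ_x ν(S_x) → P_{p_c}(E)`; here
**`|Λ(n)|⁻² Σ_{x,y ∈ Λ(n)} ν(S_x ∩ S_y) → P_{p_c}(E)²`**.  Consequently the empirical density `A_n = |Λ(n)|⁻¹ #{x ∈ Λ(n) : ω + x ∈ E}`
satisfies `E_ν A_n → P_{p_c}(E)` and `E_ν A_n² → P_{p_c}(E)²`, i.e. `A_n → P_{p_c}(E)` in `L²(ν)`: under the incipient infinite cluster, local
patterns occur in large boxes with their CRITICAL frequencies (mean-square ergodic theorem for the non-stationary measure `ν`).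
Proof: uniform mixing (`iicMeasure_abs_real_inter_preimage_shift_sub_le_criticalProbI`) handles the pairs with `y` far from the root and the
edge sets of `S_x`, `S_y` disjoint; the pointwise limit `ν(S_x) → P_{p_c}(E)` handles `x`; the exceptional pairs (`y` near the root, `x` in a
finite set, `y − x` in the finite difference set of the endpoints) number `O(|Λ(n)|) = o(|Λ(n)|²)`.

* `sub_mem_image_of_not_disjoint_image_shift` — if the translates `F − x`, `F − y` of a finite edge set share an edge then `y − x ∈ W − W`;
* `tendsto_boxPairAverage_of_uniformMixing` — the abstract step: uniform mixing + the pointwise limit ⇒ the pair averages converge;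
* **`iicMeasure_tendsto_boxPairAverage_real_preimage_shift_criticalProbI`** (ℤ^d under (A2)□), **`…_Z2`** (unconditional).

Helper file for the crux `stmt-CriticalPhenomena-4575` chain; no definitions, no sorries.
References: H. Kesten, PTRF 73 (1986) 369–394, Thm. (3), (1.12)–(1.13); G. Grimmett, *Percolation* (1999), §2.2.
-/

noncomputable section

namespace Summit.CriticalPhenomena.PercolationContinuityZ3.Theorems.Crossing

open MeasureTheory ProbabilityTheory Filter Topology
open Literature.Probability.Percolation Literature.Probability.LatticeModels
open Literature.Probability.Percolation.DCT16
open scoped ENNReal ProbabilityTheory Literature.Probability.Percolation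

variable {d : ℕ}

/-- If the translates `F − x` and `F − y` of a finite edge set `F` (endpoints in `W`) share an edge, then `y − x` lies in the finite difference
set `{b − a : a, b ∈ W}`. [folklore] -/
theorem sub_mem_image_of_not_disjoint_image_shift {F : Finset (Sym2 (Site d))} {W : Finset (Site d)}
    (hFW : ∀ e ∈ F, ∀ w ∈ e, w ∈ W) {x y : Site d}
    (h : ¬ Disjoint (F.image (Sym2.map (Site.shift x).symm)) (F.image (Sym2.map (Site.shift y).symm))) :
    y - x ∈ (W ×ˢ W).image fun q => q.2 - q.1 := by
  classical
  obtain ⟨e, he1, he2⟩ := Finset.not_disjoint_iff.1 h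
  obtain ⟨z₁, hz₁, rfl⟩ := Finset.mem_image.1 he1
  obtain ⟨z₂, hz₂, he⟩ := Finset.mem_image.1 he2
  induction z₁ using Sym2.ind with
  | h a a' =>
    have ha : a - x ∈ Sym2.map (Site.shift y).symm z₂ := by
      rw [he]
      exact Sym2.mem_map.2 ⟨a, Sym2.mem_mk_left _ _, Site.shift_symm_apply x a⟩
    obtain ⟨b, hb, hba⟩ := Sym2.mem_map.1 ha
    rw [Site.shift_symm_apply] at hba
    refine Finset.mem_image.2 ⟨(a, b), Finset.mem_product.2 ⟨hFW _ hz₁ a (Sym2.mem_mk_left _ _), hFW _ hz₂ b hb⟩, ?_⟩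
    show b - a = y - x
    calc b - a = b - y - (a - x) + (y - x) := by abel
      _ = y - x := by rw [hba, sub_self, zero_add]

/-- **Pair averages from uniform mixing** (`d ≥ 1`, any `p`, any probability measure `ν`): if for the cylinder event `E` (edges `F`,
endpoints in `W`) and `S_v = {ω | ω + v ∈ E}` (i) for every `δ > 0`, beyond some box the translates mix uniformly —
`|ν(G ∩ S_v) − ν(G)·P_p(E)| ≤ δ` for every cylinder `G` on edges disjoint from `F − v` — and (ii) `ν(S_v) → P_p(E)` along the cofinite filter,
then **`|Λ(n)|⁻² Σ_{x,y ∈ Λ(n)} ν(S_x ∩ S_y) → P_p(E)²`** (the exceptional pairs are `O(|Λ(n)|)`). [folklore] -/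
theorem tendsto_boxPairAverage_of_uniformMixing (hd : 1 ≤ d) (p : unitInterval) {ν : Measure (BondConfig (Site d))}
    [IsProbabilityMeasure ν] {F : Finset (Sym2 (Site d))} {W : Finset (Site d)} (hFW : ∀ e ∈ F, ∀ w ∈ e, w ∈ W)
    {E : Set (BondConfig (Site d))} (hE : DeterminedBy E (↑F : Set (Sym2 (Site d))))
    (hmix : ∀ δ : ℝ, 0 < δ → ∃ n₀ : ℕ, ∀ v : Site d, (∀ w ∈ W, w - v ∉ box d n₀) →
      ∀ (T : Finset (Sym2 (Site d))) (G : Set (BondConfig (Site d))), DeterminedBy G (↑T : Set (Sym2 (Site d))) →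
        Disjoint T (F.image (Sym2.map (Site.shift v).symm)) →
        |ν.real (G ∩ BondConfig.relabel (sym2Equiv (Site.shift v)) ⁻¹' E) - ν.real G * (bondPercolation (zdGraph d) p).real E| ≤ δ)
    (hlim : Tendsto (fun v : Site d => ν.real (BondConfig.relabel (sym2Equiv (Site.shift v)) ⁻¹' E)) cofinite
      (𝓝 ((bondPercolation (zdGraph d) p).real E))) :
    Tendsto (fun n : ℕ => (∑ x ∈ box d n, ∑ y ∈ box d n,
        ν.real (BondConfig.relabel (sym2Equiv (Site.shift x)) ⁻¹' E ∩ BondConfig.relabel (sym2Equiv (Site.shift y)) ⁻¹' E)) /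
          ((box d n).card : ℝ) ^ 2)
      atTop (𝓝 ((bondPercolation (zdGraph d) p).real E ^ 2)) := by
  classical
  set μ := bondPercolation (zdGraph d) p with hμ
  set P : ℝ := μ.real E with hP
  set S : Site d → Set (BondConfig (Site d)) := fun x => BondConfig.relabel (sym2Equiv (Site.shift x)) ⁻¹' E with hS
  have hP0 : 0 ≤ P := measureReal_nonneg
  have hP1 : P ≤ 1 := measureReal_le_one
  rw [Metric.tendsto_nhds]
  intro ε hε
  set δ : ℝ := ε / 4 with hδ
  have hδ0 : 0 < δ := by positivity
  -- (i) uniform mixing beyond `n₀`; the exceptional `y` form the finite set `B₁`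
  obtain ⟨n₀, hn₀⟩ := hmix δ hδ0
  set B₁ : Finset (Site d) := W.biUnion fun w => (box d n₀).image fun b => w - b with hB₁
  have hB₁' : ∀ y, y ∉ B₁ → ∀ w ∈ W, w - y ∉ box d n₀ := by
    intro y hy w hw hwy
    exact hy (Finset.mem_biUnion.2 ⟨w, hw, Finset.mem_image.2 ⟨w - y, hwy, sub_sub_cancel w y⟩⟩)
  -- (ii) the pointwise limit; the exceptional `x` form the finite set `B₂`
  have hpt : ∀ᶠ x : Site d in cofinite, dist (ν.real (S x)) P < δ := Metric.tendsto_nhds.1 hlim δ hδ0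
  rw [Filter.eventually_cofinite] at hpt
  set B₂ : Finset (Site d) := hpt.toFinset with hB₂
  have hB₂' : ∀ x, x ∉ B₂ → |ν.real (S x) - P| < δ := fun x hx => by
    by_contra h
    exact hx (hpt.mem_toFinset.2 (by rwa [Set.mem_setOf_eq, Real.dist_eq]))
  -- (iii) the difference set of the endpoints
  set D : Finset (Site d) := (W ×ˢ W).image fun q => q.2 - q.1 with hD
  -- the pointwise bound
  set K : ℝ := (B₁.card : ℝ) + B₂.card + D.card with hK
  have hbound : ∀ x y : Site d, |ν.real (S x ∩ S y) - P ^ 2| ≤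
      (2 * δ + if x ∈ B₂ then 1 else 0) + ((if y ∈ B₁ then 1 else 0) + if y - x ∈ D then 1 else 0) := by
    intro x y
    have ha0 : 0 ≤ ν.real (S x ∩ S y) := measureReal_nonneg
    have ha1 : ν.real (S x ∩ S y) ≤ 1 := measureReal_le_one
    have htriv : |ν.real (S x ∩ S y) - P ^ 2| ≤ 1 := by
      rw [abs_le]; constructor <;> nlinarith
    by_cases hx : x ∈ B₂
    · rw [if_pos hx]; split_ifs <;> linarith
    by_cases hy : y ∈ B₁
    · rw [if_pos hy, if_neg hx]; split_ifs <;> linarith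
    by_cases hxy : y - x ∈ D
    · rw [if_pos hxy, if_neg hx, if_neg hy]; linarith
    rw [if_neg hx, if_neg hy, if_neg hxy, add_zero, add_zero, add_zero]
    -- a good pair: mixing and the pointwise limit
    have hdisj : Disjoint (F.image (Sym2.map (Site.shift x).symm)) (F.image (Sym2.map (Site.shift y).symm)) := by
      by_contra h
      exact hxy (sub_mem_image_of_not_disjoint_image_shift hFW h)
    have hmix := hn₀ y (hB₁' y hy) _ (S x) (determinedBy_preimage_relabel_shift hE x) hdisj
    have hx' := hB₂' x hx
    have h2 : |ν.real (S x) * P - P ^ 2| ≤ δ := by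
      rw [show ν.real (S x) * P - P ^ 2 = (ν.real (S x) - P) * P by ring, abs_mul, abs_of_nonneg hP0]
      calc |ν.real (S x) - P| * P ≤ δ * 1 := mul_le_mul hx'.le hP1 hP0 hδ0.le
        _ = δ := mul_one δ
    calc |ν.real (S x ∩ S y) - P ^ 2|
        = |(ν.real (S x ∩ S y) - ν.real (S x) * P) + (ν.real (S x) * P - P ^ 2)| := by ring_nf
      _ ≤ |ν.real (S x ∩ S y) - ν.real (S x) * P| + |ν.real (S x) * P - P ^ 2| := abs_add_le _ _
      _ ≤ δ + δ := add_le_add hmix h2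
      _ = 2 * δ := by ring
  -- summing the bound over `Λ(n) × Λ(n)`
  have hsum : ∀ n : ℕ, ∑ x ∈ box d n, ∑ y ∈ box d n, |ν.real (S x ∩ S y) - P ^ 2| ≤
      2 * δ * ((box d n).card : ℝ) ^ 2 + K * (box d n).card := by
    intro n
    set N : ℝ := ((box d n).card : ℝ) with hN
    have hN0 : 0 ≤ N := Nat.cast_nonneg _
    set bx : Site d → ℝ := fun x => if x ∈ B₂ then 1 else 0 with hbx
    have hin : ∀ x ∈ box d n, ∑ y ∈ box d n, |ν.real (S x ∩ S y) - P ^ 2| ≤ N * (2 * δ) + N * bx x + (B₁.card + D.card) := by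
      intro x _
      have hc₁ : (((box d n).filter fun y => y ∈ B₁).card : ℝ) ≤ B₁.card := by
        exact_mod_cast Finset.card_le_card fun y hy => (Finset.mem_filter.1 hy).2
      have hc₂ : (((box d n).filter fun y => y - x ∈ D).card : ℝ) ≤ D.card := by
        refine Nat.cast_le.2 (Finset.card_le_card_of_injOn (fun y => y - x) (fun y hy => ?_) ?_)
        · exact Finset.mem_coe.2 (Finset.mem_filter.1 (Finset.mem_coe.1 hy)).2
        · intro y₁ _ y₂ _ h
          exact sub_left_injective h
      have hle : ∑ y ∈ box d n, |ν.real (S x ∩ S y) - P ^ 2| ≤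
          ∑ y ∈ box d n, ((2 * δ + bx x) + ((if y ∈ B₁ then (1 : ℝ) else 0) + if y - x ∈ D then (1 : ℝ) else 0)) :=
        Finset.sum_le_sum fun y _ => hbound x y
      have hsplit : ∑ y ∈ box d n, ((2 * δ + bx x) + ((if y ∈ B₁ then (1 : ℝ) else 0) + if y - x ∈ D then (1 : ℝ) else 0)) =
          (∑ _y ∈ box d n, 2 * δ + ∑ _y ∈ box d n, bx x) +
            (∑ y ∈ box d n, (if y ∈ B₁ then (1 : ℝ) else 0) + ∑ y ∈ box d n, (if y - x ∈ D then (1 : ℝ) else 0)) := by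
        simp only [Finset.sum_add_distrib]
      have hA : ∑ _y ∈ box d n, 2 * δ = N * (2 * δ) := by rw [Finset.sum_const, nsmul_eq_mul]
      have hB : ∑ _y ∈ box d n, bx x = N * bx x := by rw [Finset.sum_const, nsmul_eq_mul]
      have h2 : ∑ y ∈ box d n, (if y ∈ B₁ then (1 : ℝ) else 0) = (((box d n).filter fun y => y ∈ B₁).card : ℝ) :=
        Finset.sum_boole _ _
      have h3 : ∑ y ∈ box d n, (if y - x ∈ D then (1 : ℝ) else 0) = (((box d n).filter fun y => y - x ∈ D).card : ℝ) :=
        Finset.sum_boole _ _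
      linarith [hle, hsplit, hA, hB, h2, h3, hc₁, hc₂]
    have hc : (((box d n).filter fun x => x ∈ B₂).card : ℝ) ≤ B₂.card := by
      exact_mod_cast Finset.card_le_card fun x hx => (Finset.mem_filter.1 hx).2
    have hle : ∑ x ∈ box d n, ∑ y ∈ box d n, |ν.real (S x ∩ S y) - P ^ 2| ≤
        ∑ x ∈ box d n, (N * (2 * δ) + N * bx x + (B₁.card + D.card)) := Finset.sum_le_sum hin
    have hsplit : ∑ x ∈ box d n, (N * (2 * δ) + N * bx x + ((B₁.card : ℝ) + D.card)) =
        ∑ _x ∈ box d n, N * (2 * δ) + ∑ x ∈ box d n, N * bx x + ∑ _x ∈ box d n, ((B₁.card : ℝ) + D.card) := by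
      simp only [Finset.sum_add_distrib]
    have e1 : ∑ _x ∈ box d n, N * (2 * δ) = N * (N * (2 * δ)) := by rw [Finset.sum_const, nsmul_eq_mul]
    have e2 : ∑ x ∈ box d n, N * bx x = N * ∑ x ∈ box d n, bx x := by rw [Finset.mul_sum]
    have e3 : ∑ _x ∈ box d n, ((B₁.card : ℝ) + D.card) = N * ((B₁.card : ℝ) + D.card) := by rw [Finset.sum_const, nsmul_eq_mul]
    have e4 : ∑ x ∈ box d n, bx x = (((box d n).filter fun x => x ∈ B₂).card : ℝ) := Finset.sum_boole _ _
    have e5 : N * ∑ x ∈ box d n, bx x ≤ N * B₂.card := mul_le_mul_of_nonneg_left (by rw [e4]; exact hc) hN0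
    have hK' : K * N = N * B₁.card + N * B₂.card + N * D.card := by rw [hK]; ring
    nlinarith [hle, hsplit, e1, e2, e3, e5, hK']
  -- conclusion
  have hcard := tendsto_card_box_atTop (d := d) hd
  have hsmall : ∀ᶠ n : ℕ in atTop, K / ((box d n).card : ℝ) < ε / 4 :=
    (tendsto_const_nhds.div_atTop hcard) |>.eventually (gt_mem_nhds (by positivity))
  have hpos : ∀ᶠ n : ℕ in atTop, (0 : ℝ) < (box d n).card := hcard.eventually (eventually_gt_atTop 0)
  filter_upwards [hsmall, hpos] with n hn hnpos
  have hN2 : 0 < ((box d n).card : ℝ) ^ 2 := pow_pos hnpos 2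
  rw [Real.dist_eq]
  have hinner : ∀ x, ∑ y ∈ box d n, (ν.real (S x ∩ S y) - P ^ 2) =
      ∑ y ∈ box d n, ν.real (S x ∩ S y) - ((box d n).card : ℝ) * P ^ 2 := fun x => by
    rw [Finset.sum_sub_distrib, Finset.sum_const, nsmul_eq_mul]
  have hsub : ∑ x ∈ box d n, ∑ y ∈ box d n, (ν.real (S x ∩ S y) - P ^ 2) =
      ∑ x ∈ box d n, ∑ y ∈ box d n, ν.real (S x ∩ S y) - ((box d n).card : ℝ) ^ 2 * P ^ 2 := by
    rw [Finset.sum_congr rfl fun x _ => hinner x, Finset.sum_sub_distrib, Finset.sum_const, nsmul_eq_mul]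
    ring
  have hrew : (∑ x ∈ box d n, ∑ y ∈ box d n, ν.real (S x ∩ S y)) / ((box d n).card : ℝ) ^ 2 - P ^ 2 =
      (∑ x ∈ box d n, ∑ y ∈ box d n, (ν.real (S x ∩ S y) - P ^ 2)) / ((box d n).card : ℝ) ^ 2 := by
    rw [hsub, sub_div, mul_div_cancel_left₀ _ hN2.ne']
  rw [hrew, abs_div, abs_of_pos hN2, div_lt_iff₀ hN2]
  calc |∑ x ∈ box d n, ∑ y ∈ box d n, (ν.real (S x ∩ S y) - P ^ 2)|
      ≤ ∑ x ∈ box d n, |∑ y ∈ box d n, (ν.real (S x ∩ S y) - P ^ 2)| := Finset.abs_sum_le_sum_abs _ _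
    _ ≤ ∑ x ∈ box d n, ∑ y ∈ box d n, |ν.real (S x ∩ S y) - P ^ 2| :=
        Finset.sum_le_sum fun x _ => Finset.abs_sum_le_sum_abs _ _
    _ ≤ 2 * δ * ((box d n).card : ℝ) ^ 2 + K * (box d n).card := hsum n
    _ < ε * ((box d n).card : ℝ) ^ 2 := by
        have hKN : K < ε / 4 * (box d n).card := by rwa [div_lt_iff₀ hnpos] at hn
        have hKN' : K * (box d n).card < ε / 4 * ((box d n).card : ℝ) ^ 2 := by nlinarith
        rw [hδ]
        nlinarith


/-- **`L²`-ERGODIC THEOREM FOR THE IIC (ℤ^d, under (A2)□)**: at `p_c(ℤ^d)`, `d ≥ 2`, under (A2)□ at aspect `(s,L)`, for every probability measure `ν`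
with Kesten's IIC limit property and every cylinder event `E`, with `S_x = {ω | ω + x ∈ E}`:
**`|Λ(n)|⁻² · Σ_{x, y ∈ Λ(n)} ν(S_x ∩ S_y) → P_{p_c}(E)²`**.  With `iicMeasure_tendsto_boxAverage_real_preimage_shift_criticalProbI`
(`E_ν A_n → P_{p_c}(E)`) this is `E_ν A_n² → P_{p_c}(E)²` for the empirical density `A_n` of the pattern `E` in `Λ(n)`, i.e. `A_n → P_{p_c}(E)`
in `L²(ν)`. [cite: Kesten1986, Thm. (3), (1.12)–(1.13)] [cite: BasuSapozhnikov2017ECP, Thm. 1.1 and §1 (A2)] -/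
theorem iicMeasure_tendsto_boxPairAverage_real_preimage_shift_criticalProbI (hd : 2 ≤ d) {s L : ℕ} (hs : 2 ≤ s) (hsL : s ≤ L) {ϰ : ℝ}
    (hϰ : 0 < ϰ) (hA2 : SetToSetQuasiMultAspectAt d (criticalProbI d) s L ϰ) {ν : Measure (BondConfig (Site d))}
    [IsProbabilityMeasure ν]
    (hν : ∀ (F : Finset (Sym2 (Site d))) (E : Set (BondConfig (Site d))), MeasurableSet E → DeterminedBy E ↑F →
      Tendsto (fun n : ℕ => (bondPercolation (zdGraph d) (criticalProbI d)).real (E ∩ siteToBoundary d n) /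
        oneArmProb d (criticalProbI d) n) atTop (𝓝 (ν.real E)))
    {F : Finset (Sym2 (Site d))} {E : Set (BondConfig (Site d))} (hE : DeterminedBy E (↑F : Set (Sym2 (Site d)))) :
    Tendsto (fun n : ℕ => (∑ x ∈ box d n, ∑ y ∈ box d n,
        ν.real (BondConfig.relabel (sym2Equiv (Site.shift x)) ⁻¹' E ∩ BondConfig.relabel (sym2Equiv (Site.shift y)) ⁻¹' E)) /
          ((box d n).card : ℝ) ^ 2)
      atTop (𝓝 ((bondPercolation (zdGraph d) (criticalProbI d)).real E ^ 2)) := by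
  obtain ⟨W, hFW⟩ := exists_finset_forall_mem_of_mem F
  exact tendsto_boxPairAverage_of_uniformMixing (by omega) (criticalProbI d) hFW hE
    (fun δ hδ => iicMeasure_abs_real_inter_preimage_shift_sub_le_criticalProbI hd hs hsL hϰ hA2 hν hFW hE hδ)
    (iicMeasure_tendsto_real_preimage_shift_criticalProbI hd hs hsL hϰ hA2 hν hE)

/-- **`L²`-ERGODIC THEOREM FOR THE PLANAR IIC, unconditionally**: for every probability measure `ν` with Kesten's IIC limit property at
`p_c(ℤ²) = 1/2` and every cylinder event `E`: **`|Λ(n)|⁻² · Σ_{x, y ∈ Λ(n)} ν(S_x ∩ S_y) → P_{1/2}(E)²`**.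
[cite: Kesten1986, Thm. (3), (1.12)–(1.13)] -/
theorem iicMeasure_tendsto_boxPairAverage_real_preimage_shift_Z2 {ν : Measure (BondConfig (Site 2))} [IsProbabilityMeasure ν]
    (hν : ∀ (F : Finset (Sym2 (Site 2))) (E : Set (BondConfig (Site 2))), MeasurableSet E → DeterminedBy E ↑F →
      Tendsto (fun n : ℕ => (bondPercolation (zdGraph 2) (criticalProbI 2)).real (E ∩ siteToBoundary 2 n) /
        oneArmProb 2 (criticalProbI 2) n) atTop (𝓝 (ν.real E)))
    {F : Finset (Sym2 (Site 2))} {E : Set (BondConfig (Site 2))} (hE : DeterminedBy E (↑F : Set (Sym2 (Site 2)))) :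
    Tendsto (fun n : ℕ => (∑ x ∈ box 2 n, ∑ y ∈ box 2 n,
        ν.real (BondConfig.relabel (sym2Equiv (Site.shift x)) ⁻¹' E ∩ BondConfig.relabel (sym2Equiv (Site.shift y)) ⁻¹' E)) /
          ((box 2 n).card : ℝ) ^ 2)
      atTop (𝓝 ((bondPercolation (zdGraph 2) (criticalProbI 2)).real E ^ 2)) := by
  obtain ⟨W, hFW⟩ := exists_finset_forall_mem_of_mem F
  exact tendsto_boxPairAverage_of_uniformMixing (d := 2) (by norm_num) (criticalProbI 2) hFW hE
    (fun δ hδ => iicMeasure_abs_real_inter_preimage_shift_sub_le_Z2 hν hFW hE hδ)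
    (iicMeasure_tendsto_real_preimage_shift_Z2 hν hE)

end Summit.CriticalPhenomena.PercolationContinuityZ3.Theorems.Crossing

end
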